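import Literature.NumberTheory.EllipticCurves.KatoAdditiveTwistedValueNeronIntegralityThree
import Literature.NumberTheory.EllipticCurves.ModularSymbolsProofs
import Literature.NumberTheory.EllipticCurves.PAdicLFunctionProofs
import Literature.NumberTheory.EllipticCurves.PAdicLFunctionDistributionProofs
import Literature.NumberTheory.EllipticCurves.SkinnerUrban2014.PAdicUnitImaginaryPeriodRatioProofs
import HarnessLib

/-!
# Route `ManinLocalTwoThree`, crux C3 `ManinPrimeToThreeAtNine` (stmt-BirchSwinnertonDyer-22968), line
# `kato-shift-three` (es g6): the prime classes `{0, a/ℓ}_f` in lattice units — periods, integrality,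
# oddness, and the odd twisted sum `Σ_a χ(a){∞, a/ℓ}_f = i·(Ω⁻_f/2)·Σ_a χ(a) y(a)` (line prover p1; helper)

Modular-symbol bookkeeping for the Euler-system step `stub_three_dvd_shiftClass` (no Kato here):
for a cusp form `f ∈ S₂(Γ₀(N))` with real coefficients and a prime `ℓ ∤ N`,
* `exists_gamma0_entry` / `primeClass_mem_periodLattice` — `{∞, a/ℓ}_f − {∞, 0}_f ∈ Λ_f` for `ℓ ∤ a`
  (a matrix `(x a; −Ns ℓ) ∈ Γ₀(N)` from Bézout and Manin's relation `modularSymbol_gamma0_smul_holds`);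
* `primeClassZMod`, `primeClassZMod_im_mem`, `exists_int_primeClassZMod_im` — as a function on `ℤ/ℓ`
  (`{∞, r + n} = {∞, r}`), its imaginary part lies in `ℤ·(Ω⁻_f/2)` when `Ω⁻_f > 0`;
* `primeClassZMod_neg` — `{0, −a/ℓ} = conj {0, a/ℓ}` (real coefficients), so the lattice coordinate
  `y(a) = Im{0,a/ℓ}/(Ω⁻_f/2)` is ODD;
* `twistedSymbolSum_eq_I_mul` — for an ODD character `χ ≠ 1` mod `ℓ`:
  `Σ_a χ(a){∞, a/ℓ}_f = i · Σ_a χ(a)·Im{0, a/ℓ}_f`.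
Nothing about BSD or Manin's conjecture is proved here.
-/

set_option autoImplicit false
set_option linter.dupNamespace false

noncomputable section

open scoped Classical MatrixGroups ModularForm

open CongruenceSubgroup Complex Literature.NumberTheory.EllipticCurves
  Literature.NumberTheory.EllipticCurves.ModularForms

namespace Summit.BirchSwinnertonDyer.BirchSwinnertonDyer.Theorems.ManinLocalTwoThree

section PrimeClass

variable {N : ℕ} [NeZero N] (f : CuspForm (Gamma0 N) 2)

omit [NeZero N] in
/-- **A `Γ₀(N)`-matrix with prescribed second column `(a, ℓ)`** when `gcd(ℓ, aN) = 1`: Bézout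
`xℓ + s(aN) = 1` gives `(x a; −Ns ℓ) ∈ Γ₀(N)`. [folklore] -/
theorem exists_gamma0_entry {ℓ a : ℤ} (h : IsCoprime ℓ (a * N)) :
    ∃ γ : Gamma0 N, ((γ : SL(2, ℤ)) 0 1 = a) ∧ ((γ : SL(2, ℤ)) 1 1 = ℓ) := by
  obtain ⟨x, s, hxs⟩ := h
  let M : Matrix (Fin 2) (Fin 2) ℤ := !![x, a; -(N * s), ℓ]
  have hdet : M.det = 1 := by
    rw [Matrix.det_fin_two_of]
    linear_combination hxs
  let γ : SL(2, ℤ) := ⟨M, hdet⟩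
  have hmem : γ ∈ Gamma0 N := by
    rw [Gamma0_mem]
    show (((-(N * s) : ℤ)) : ZMod N) = 0
    push_cast
    simp
  exact ⟨⟨γ, hmem⟩, rfl, rfl⟩

/-- **`{∞, a/ℓ}_f − {∞, 0}_f ∈ Λ_f`** for `gcd(ℓ, aN) = 1` (`ℓ ≠ 0`): the class `{0, a/ℓ}` is closed
on `X₀(N)` (Manin: `{∞, γ0} = {∞, γ∞} + {∞, 0}` for `γ = (x a; −Ns ℓ) ∈ Γ₀(N)`).
[cite: Manin1972, Prop. 1.4 / Thm. 1.6] -/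
theorem primeClass_mem_periodLattice {ℓ a : ℤ} (hℓ : ℓ ≠ 0) (h : IsCoprime ℓ (a * N)) :
    modularSymbol f ((a : ℚ) / ℓ) - modularSymbol f 0 ∈ periodLattice f := by
  obtain ⟨γ, h01, h11⟩ := exists_gamma0_entry (N := N) h
  have hne : (((γ : SL(2, ℤ)) 1 0 : ℤ) : ℚ) * 0 + (((γ : SL(2, ℤ)) 1 1 : ℤ) : ℚ) ≠ 0 := by
    rw [mul_zero, zero_add, h11]; exact_mod_cast hℓ
  have hM := modularSymbol_gamma0_smul_holds f γ 0 hne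
  rw [mul_zero, zero_add, mul_zero, zero_add, h01, h11] at hM
  rw [hM, add_sub_cancel_right]
  exact cuspSymbol_mem_periodLattice f γ

variable {ℓ : ℕ}

/-- The prime class as a function on `ℤ/ℓ`: `x ↦ {∞, x̃/ℓ}_f − {∞, 0}_f` with `x̃ = x.val`. [folklore] -/
theorem modularSymbol_div_eq_of_intCast (hℓ : ℓ ≠ 0) (b : ℤ) :
    modularSymbol f ((((b : ZMod ℓ).val : ℕ) : ℚ) / ℓ) = modularSymbol f ((b : ℚ) / ℓ) := by
  haveI : NeZero ℓ := ⟨hℓ⟩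
  have h1 : (((b : ZMod ℓ).val : ℕ) : ℤ) = b % ℓ := ZMod.val_intCast b
  have hℓ0 : (ℓ : ℚ) ≠ 0 := by exact_mod_cast hℓ
  have h2 : ((((b : ZMod ℓ).val : ℕ) : ℚ) / ℓ) = (b : ℚ) / ℓ + ((-(b / ℓ) : ℤ) : ℚ) := by
    have h3 : ((((b : ZMod ℓ).val : ℕ) : ℤ) : ℚ) = ((b % ℓ : ℤ) : ℚ) := by exact_mod_cast h1
    rw [Int.emod_def] at h3
    push_cast at h3 ⊢
    rw [h3]
    field_simp
    ring
  rw [h2, modularSymbol_add_intCast_holds f]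

/-- **The prime class is a period**: for a prime `ℓ ∤ N` and `x ≠ 0` mod `ℓ`,
`{∞, x̃/ℓ}_f − {∞, 0}_f ∈ Λ_f`. [cite: Manin1972, Prop. 1.4 / Thm. 1.6] -/
theorem primeClassZMod_mem_periodLattice (hℓ : ℓ.Prime) (hℓN : ¬ ℓ ∣ N) (x : ZMod ℓ) (hx : x ≠ 0) :
    modularSymbol f (((x.val : ℕ) : ℚ) / ℓ) - modularSymbol f 0 ∈ periodLattice f := by
  haveI : Fact ℓ.Prime := ⟨hℓ⟩
  have hval : ¬ ℓ ∣ x.val := by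
    intro h
    have hlt : x.val < ℓ := ZMod.val_lt x
    have hpos : 0 < x.val := Nat.pos_of_ne_zero ((ZMod.val_ne_zero x).mpr hx)
    exact absurd (Nat.le_of_dvd hpos h) (not_le.mpr hlt)
  have hcop : IsCoprime (ℓ : ℤ) (((x.val : ℕ) : ℤ) * N) := by
    refine IsCoprime.mul_right ?_ ?_
    · rw [Int.isCoprime_iff_gcd_eq_one, Int.gcd_natCast_natCast]
      exact (Nat.Prime.coprime_iff_not_dvd hℓ).mpr hval
    · rw [Int.isCoprime_iff_gcd_eq_one, Int.gcd_natCast_natCast]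
      exact (Nat.Prime.coprime_iff_not_dvd hℓ).mpr hℓN
  have h := primeClass_mem_periodLattice f (by exact_mod_cast hℓ.ne_zero) hcop
  simpa only [Int.cast_natCast] using h

/-- **Integrality of the lattice coordinate**: for a prime `ℓ ∤ N` and `x ≠ 0` mod `ℓ`,
`Im({∞, x̃/ℓ}_f − {∞, 0}_f) = n·(Ω⁻_f/2)` for an integer `n`, when `Ω⁻_f > 0`. [folklore] -/
theorem exists_int_im_primeClassZMod (hℓ : ℓ.Prime) (hℓN : ¬ ℓ ∣ N) (hpos : 0 < minusPeriod f)
    (x : ZMod ℓ) (hx : x ≠ 0) :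
    ∃ n : ℤ, (modularSymbol f (((x.val : ℕ) : ℚ) / ℓ) - modularSymbol f 0).im =
      n * (minusPeriod f / 2) := by
  have hmem : (modularSymbol f (((x.val : ℕ) : ℚ) / ℓ) - modularSymbol f 0).im ∈ imagPeriods f :=
    AddSubgroup.mem_map.mpr ⟨_, primeClassZMod_mem_periodLattice f hℓ hℓN x hx, rfl⟩
  rw [SkinnerUrban2014.imagPeriods_eq_zmultiples_of_minusPeriod_pos f hpos,
    AddSubgroup.mem_zmultiples_iff] at hmem
  obtain ⟨n, hn⟩ := hmem
  exact ⟨n, by rw [← hn, zsmul_eq_mul]⟩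

/-- **Oddness**: `{∞, (−x)̃/ℓ} − {∞,0} = conj({∞, x̃/ℓ} − {∞,0})` for `f` with real coefficients, hence the
imaginary parts are opposite. [cite: CremonaAlgorithms1997, §2.8] -/
theorem im_primeClassZMod_neg (hℓ : ℓ ≠ 0) (hreal : ∀ n, (cuspCoeff f n).im = 0) (x : ZMod ℓ) :
    (modularSymbol f ((((-x).val : ℕ) : ℚ) / ℓ) - modularSymbol f 0).im =
      -(modularSymbol f (((x.val : ℕ) : ℚ) / ℓ) - modularSymbol f 0).im := by
  haveI : NeZero ℓ := ⟨hℓ⟩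
  have hx : (-x) = ((-(x.val : ℤ) : ℤ) : ZMod ℓ) := by
    rw [Int.cast_neg, Int.cast_natCast, ZMod.natCast_zmod_val]
  have h1 : modularSymbol f ((((-x).val : ℕ) : ℚ) / ℓ) = modularSymbol f ((((-(x.val : ℤ) : ℤ)) : ℚ) / ℓ) := by
    conv_lhs => rw [hx]
    exact modularSymbol_div_eq_of_intCast f hℓ _
  have h2 : ((((-(x.val : ℤ) : ℤ)) : ℚ) / ℓ) = -((((x.val : ℕ)) : ℚ) / ℓ) := by push_cast; ring
  rw [h1, h2, modularSymbol_neg_eq_conj_holds f hreal]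
  have h0 : modularSymbol f 0 = starRingEnd ℂ (modularSymbol f 0) := by
    have := modularSymbol_neg_eq_conj_holds f hreal 0
    rwa [neg_zero] at this
  rw [Complex.sub_im, Complex.sub_im, Complex.conj_im]
  have : (modularSymbol f 0).im = 0 := by
    have h := congrArg Complex.im h0
    rw [Complex.conj_im] at h
    linarith
  rw [this]; ring

/-- **The odd twisted sum in lattice coordinates**: for an ODD character `χ` mod `ℓ` and `f` with real
coefficients, `Σ_a χ(a){∞, a/ℓ}_f = i · Σ_a χ(a)·Im({∞,a/ℓ}_f − {∞,0}_f)`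
(`Σ_a χ(a) = 0` removes `{∞,0}`; `a ↦ −a` and `{∞,−r} = conj{∞,r}` remove the real parts).
[cite: MazurTateTeitelbaum1986, §I.8] -/
theorem twistedSymbolSum_eq_I_mul_sum (hℓ : ℓ ≠ 0) (hreal : ∀ n, (cuspCoeff f n).im = 0)
    (χ : DirichletCharacter ℂ ℓ) (hχ : χ.Odd) :
    haveI : NeZero ℓ := ⟨hℓ⟩
    twistedSymbolSum f χ =
      I * ∑ x : ZMod ℓ, χ x *
        (((modularSymbol f (((x.val : ℕ) : ℚ) / ℓ) - modularSymbol f 0).im : ℝ) : ℂ) := by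
  haveI : NeZero ℓ := ⟨hℓ⟩
  have hχ1 : χ ≠ 1 := by
    intro h
    have h1 : χ (-1) = -1 := hχ
    rw [h, MulChar.one_apply (isUnit_one.neg)] at h1
    norm_num at h1
  set P : ZMod ℓ → ℂ := fun x ↦ modularSymbol f (((x.val : ℕ) : ℚ) / ℓ) - modularSymbol f 0 with hP
  -- remove `{∞, 0}`
  have hT : twistedSymbolSum f χ = ∑ x : ZMod ℓ, χ x * P x := by
    unfold twistedSymbolSum
    have : ∑ x : ZMod ℓ, χ x * P x =
        ∑ x : ZMod ℓ, χ x * modularSymbol f (((x.val : ℕ) : ℚ) / ℓ) -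
          (∑ x : ZMod ℓ, χ x) * modularSymbol f 0 := by
      simp only [hP, mul_sub, Finset.sum_sub_distrib, Finset.sum_mul]
    rw [this, MulChar.sum_eq_zero_of_ne_one hχ1, zero_mul, sub_zero]
  -- `P(−x) = conj (P x)`
  have hconj : ∀ x : ZMod ℓ, P (-x) = starRingEnd ℂ (P x) := by
    intro x
    apply Complex.ext
    · -- real parts: `re conj = re`; and re P(−x) = re P(x)
      simp only [hP, Complex.conj_re]
      have hx : (-x) = ((-(x.val : ℤ) : ℤ) : ZMod ℓ) := by
        rw [Int.cast_neg, Int.cast_natCast, ZMod.natCast_zmod_val]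
      have h1 : modularSymbol f ((((-x).val : ℕ) : ℚ) / ℓ) =
          modularSymbol f ((((-(x.val : ℤ) : ℤ)) : ℚ) / ℓ) := by
        conv_lhs => rw [hx]
        exact modularSymbol_div_eq_of_intCast f hℓ _
      have h2 : ((((-(x.val : ℤ) : ℤ)) : ℚ) / ℓ) = -((((x.val : ℕ)) : ℚ) / ℓ) := by push_cast; ring
      rw [h1, h2, modularSymbol_neg_eq_conj_holds f hreal, Complex.sub_re, Complex.sub_re,
        Complex.conj_re]
    · rw [Complex.conj_im]
      exact im_primeClassZMod_neg f hℓ hreal x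
  -- `Σ χ(x) conj(P x) = −S`
  have hS : ∑ x : ZMod ℓ, χ x * starRingEnd ℂ (P x) = -∑ x : ZMod ℓ, χ x * P x := by
    calc ∑ x : ZMod ℓ, χ x * starRingEnd ℂ (P x)
        = ∑ x : ZMod ℓ, χ x * P (-x) := by simp_rw [hconj]
      _ = ∑ x : ZMod ℓ, χ (-x) * P x := by
          rw [← Equiv.sum_comp (Equiv.neg (ZMod ℓ)) (fun x ↦ χ (-x) * P x)]
          simp only [Equiv.neg_apply, neg_neg]
      _ = ∑ x : ZMod ℓ, -(χ x * P x) := by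
          refine Finset.sum_congr rfl fun x _ ↦ ?_
          rw [show (-x) = (-1) * x by ring, map_mul, hχ]; ring
      _ = -∑ x : ZMod ℓ, χ x * P x := by rw [Finset.sum_neg_distrib]
  -- `2S = Σ χ(x)(P x − conj P x) = 2i Σ χ(x) im(P x)`
  have h2 : 2 * ∑ x : ZMod ℓ, χ x * P x =
      2 * (I * ∑ x : ZMod ℓ, χ x * (((P x).im : ℝ) : ℂ)) := by
    have hsub : ∑ x : ZMod ℓ, χ x * P x - ∑ x : ZMod ℓ, χ x * starRingEnd ℂ (P x) =
        ∑ x : ZMod ℓ, χ x * (P x - starRingEnd ℂ (P x)) := by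
      rw [← Finset.sum_sub_distrib]
      exact Finset.sum_congr rfl fun x _ ↦ by ring
    have : ∀ x : ZMod ℓ, P x - starRingEnd ℂ (P x) = 2 * (I * (((P x).im : ℝ) : ℂ)) := by
      intro x
      rw [Complex.sub_conj]
      push_cast
      ring
    rw [two_mul, ← sub_neg_eq_add, ← hS, hsub]
    simp_rw [this]
    rw [Finset.mul_sum, Finset.mul_sum]
    exact Finset.sum_congr rfl fun x _ ↦ by ring
  rw [hT]
  exact mul_left_cancel₀ two_ne_zero h2

end PrimeClass

end Summit.BirchSwinnertonDyer.BirchSwinnertonDyer.Theorems.ManinLocalTwoThree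

end
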